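import Summits.Ventures.Crystal3D.Theorems.StickyWulffConstantTextureLiminfTexShadowFreeDefs
import HarnessLib

/-!
# TexShadow v8.2 vocabulary — the residual class tested LAST: the faulted residual CORE stub
# (lane T, crux `TextureLiminfV5`, stmt-Ventures-23912; cf-p1 DECISION (xc)(1) «RES tested LAST», 2026-08-29T02:24:26Z, on wulff-p2's FAULTED-MAP)

HONEST FRAMING. Venture `Summits/Ventures/Crystal3D` (cell `crystal3d-full`), route `route-Ventures-StickyWulffConstant`, helper
`--supports` the law-v5 crux `TextureLiminfV5` (stmt-Ventures-23912).  ONE DEFINITION + one inclusion; nothing about any wall law is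
proved or claimed; rung F-C1 not moved.

THE CUT.  In TexShadow v8 the residual test `RES := ∃ i j, InResidualClass (A₁ i) (A₂ j) (u₁ i) (u₂ j)` comes FIRST, so the faulted residual stub
`BilayerWallResidualFaultedAt` (p687308) also contains every faulted pair with a residual-class frame pair that the CLOSED parts (walker-covered,
row-covered, zig-frames-apart — all idle in `hgen`) would price (FAULTED-MAP.md, row (e), example E1).  v8.2 runs the four-way tree FIRST and
tests `RES` only inside the three OWED leaves; the residual stub therefore shrinks to its honest core:
* **`BilayerWallResidualFaultedCoreAt c₀ C R₀`** — a FAULTED pair (`¬BothFcc`) WITH a residual-class bilayer-frame pair, sitting in one of the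
  three owed leaves of the tree, stated LITERALLY as the leaves' hypotheses so that the owner (19480-p2's twin-aware one-sided ledger, cf-p1
  (lxxxviii)) can case on them: (corner key) `DomBy ∧ ∃ co-axial corner frames` ∨ (zig key) `Δ-steep both ∧ flux-dominated ∧ ¬off-reach ∧
  ¬row-dominated ∧ ¬both zig-good ∧ ∃ co-axial zig frames` ∨ (pool) `¬(Δ-steep both ∧ flux-dominated) ∧ ¬row-dominated in the four
  presentations`; conclusion = the cell inequality;
* `residualFaultedCoreAt_of_residualFaultedAt` — the v8 stub implies the core stub (the core only ADDS hypotheses).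
The other two owed faulted stubs keep their registered v8 texts (`BilayerWallFaultedOnReachCoaxialAt` / `…FaultedZigCoaxialAt`,
`HStripPayerPoolFaultedAt`, with `hgen`).  The glue is the next file (`…TexShadowResLastGlue`).
WHAT THIS IS NOT: no proof of any wall law; F-C1 not moved.
-/

noncomputable section

open scoped BigOperators InnerProductSpace ENNReal
open MeasureTheory Filter

namespace Summit.Ventures.Crystal3D.Cruxes.TextureLiminf.TexShadow

open Summit.Ventures.Crystal3D Summit.Ventures.Crystal3D.Theorems
open Literature.MathematicalPhysics.StatisticalMechanics (IsHaggSeq fccStacking barlowStacking contactDeficiency basalMirror)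

/-- **THE FAULTED RESIDUAL CORE at cap `c₀` and constants `(C, R₀)`** (v8.2, `RES` tested LAST): a faulted pair (`¬BothFcc`) some facing
bilayer-frame pair of which lies in lane G's registered residual class (affinely NON-co-axial, ray-aligned, outside the seven cells,
registered) AND which sits in one of the three owed leaves of TexShadow's four-way tree — corner-keyed co-axial coincidence, zig-keyed co-axial
coincidence, or the Deficit-MIN pool regime (hypotheses verbatim those leaves') — satisfies the cell for every `c₀`-admissible table.
Owner (cf-p1 (lxxxviii)/(xc)): lane G's twin-aware thin-start one-sided ledger (19480-p2, after M1). -/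
def BilayerWallResidualFaultedCoreAt (c₀ C R₀ : ℝ) : Prop :=
  ∀ (σ₁ σ₂ : ℤ → ℤ), IsHaggSeq σ₁ → IsHaggSeq σ₂ → ¬ BothFcc σ₁ σ₂ →
    ∀ (L₁ L₂ : E3 ≃ₗᵢ[ℝ] E3) (s₁ s₂ : E3) (A₁ A₂ : ℤ → (E3 ≃ₗᵢ[ℝ] E3)) (u₁ u₂ : ℤ → E3),
    BilayerFramesAt L₁ s₁ σ₁ A₁ u₁ → BilayerFramesAt L₂ s₂ σ₂ A₂ u₂ →
    (∃ i j : ℤ, InResidualClass (A₁ i) (A₂ j) (u₁ i) (u₂ j)) →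
    ∀ (c : ℤ → ℤ → ℝ) (m : ℤ → ℤ → E3), BilayerChargeAdmissibleAt c₀ A₁ A₂ c m →
      ((DomBy L₁ σ₁ L₂ σ₂ c ∧
          ∃ F₁ ∈ cornerFrames L₁ σ₁ e₃, ∃ F₂ ∈ cornerFrames L₂ σ₂ (-e₃), CoAxFrames F₁ F₂) ∨
        (DeltaSteep L₁ e₃ ∧ DeltaSteep L₂ (-e₃) ∧ FluxDominated (Real.sqrt 2 / 2) L₁ σ₁ L₂ σ₂ c ∧
          ¬ BarlowOffReach L₁ s₁ σ₁ L₂ s₂ σ₂ ∧ ¬ RowMixDominated (Real.sqrt 2 / 2) L₁ σ₁ L₂ σ₂ c ∧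
          ¬ (ZigGood L₁ σ₁ e₃ ∧ ZigGood L₂ σ₂ (-e₃)) ∧
          ∃ F₁ ∈ zigFrames L₁ e₃, ∃ F₂ ∈ zigFrames L₂ (-e₃), CoAxFrames F₁ F₂) ∨
        (¬ (DeltaSteep L₁ e₃ ∧ DeltaSteep L₂ (-e₃) ∧ FluxDominated (Real.sqrt 2 / 2) L₁ σ₁ L₂ σ₂ c) ∧
          ¬ RowMixDominated (Real.sqrt 2 / 2) L₁ σ₁ L₂ σ₂ c ∧
          ¬ RowMixDominated (Real.sqrt 2 / 2) (basalMirror.trans L₁) (fun n => -σ₁ (-n - 1)) L₂ σ₂ (fun i j => c (-i - 1) j) ∧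
          ¬ RowMixDominated (Real.sqrt 2 / 2) L₁ σ₁ (basalMirror.trans L₂) (fun n => -σ₂ (-n - 1)) (fun i j => c i (-j - 1)) ∧
          ¬ RowMixDominated (Real.sqrt 2 / 2) (basalMirror.trans L₁) (fun n => -σ₁ (-n - 1))
              (basalMirror.trans L₂) (fun n => -σ₂ (-n - 1)) (fun i j => c (-i - 1) (-j - 1)))) →
      BilayerWallAt C R₀ σ₁ σ₂ L₁ L₂ s₁ s₂ c

/-- The v8 faulted residual stub (`RES` tested first) implies the v8.2 core stub (which only ADDS the leaf hypothesis). -/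
theorem residualFaultedCoreAt_of_residualFaultedAt {c₀ C R₀ : ℝ} (h : BilayerWallResidualFaultedAt c₀ C R₀) :
    BilayerWallResidualFaultedCoreAt c₀ C R₀ :=
  fun σ₁ σ₂ hσ₁ hσ₂ hf L₁ L₂ s₁ s₂ A₁ A₂ u₁ u₂ hA₁ hA₂ hres c m hadm _ =>
    h σ₁ σ₂ hσ₁ hσ₂ hf L₁ L₂ s₁ s₂ A₁ A₂ u₁ u₂ hA₁ hA₂ hres c m hadm

/-- The whole law in frames-∀ form implies the core stub. -/
theorem residualFaultedCoreAt_of_allAt {c₀ C R₀ : ℝ} (h : BilayerWallAllAt c₀ C R₀) : BilayerWallResidualFaultedCoreAt c₀ C R₀ :=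
  residualFaultedCoreAt_of_residualFaultedAt (residualFaultedAt_of_allAt h)

end Summit.Ventures.Crystal3D.Cruxes.TextureLiminf.TexShadow

end
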